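import Summits.Ventures.HSemireg.WedgeHankelGlue
import Summits.Ventures.HSemireg.WedgePairRank

/-!
# Venture HSemireg — THE TWO MISSING FACES OF C15's KRONECKER DICTIONARY in the wedge model: the TANGENT class `A·E₀ + B·E₁`
# (Hankel rank 2 ⇒ `P_m`, THEOREM T's third face) and the PURE class `A·Σ_j λ^j E_j` (Hankel rank 1 ⇒ `(1+t)^m`), every field, every `m`

HONEST FRAMING. Part of the Lean index of the computation cell `pub-hsemireg` (seat p10 gen 10, Sunday typer «UNIFORM-IN-n»).
Ranks of small HANKEL MATRICES over a field and th-7's THEOREM H ONLY: no variety, no cohomology theory, no sheaf, no Ext group and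
no semiregularity map is constructed here; nothing here says that HC / HC_CM / HC_AV holds; no Literature fact is declared or used.
Custodian versions cited: theory/FORMULA-N.md PART A §2.2 THEOREM T, §2.6 THEOREM H and its KRONECKER DICTIONARY («ρ = 1 pure (line
bundle / 𝒪 / pt); ρ = 2 ⟺ two exponentials (K-secant, real pair, 1 − pt) or TANGENT (Abel–Jacobi) ⟹ P_n(t) = 2(1+t)ⁿ − 1 − tⁿ; ρ = 3 generic»),
§7 FN-4; PART B §N.8 (th-7); STRUCTURE.md v1.0-SIGNED 9b196a05977dd067 §1.1 C15.  The dictionary (a class `v = Σ_j q_j Θ^j/j! ∈ K[Θ]` on an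
abelian `m`-fold ↦ th-7's Hankel class `w_m(q) = Σ_j q_j E_j`; `⌟v` on `HT^k` ↦ `θ ↦ θ ∧ w_m(q)` on `⋀^k K^{2m}`, sign-blind) is QUOTED, never asserted.

WHAT IS IN THE TREE.  THEOREM H (`WedgeHankelModel.hankelLaw_model`, th-7: `dim range(θ ↦ θ ∧ w_m(q) ∣ ⋀^k) = C(m,k)·rank H_k(q)`,
`H_k(q) = (q_{i+s})_{i ≤ k, s ≤ m−k}`), and TWO of the three faces of Hankel rank 2: the point pair `(a,0,…,0,c)` (th-7's THEOREM T,
`WedgePairRank`; its Hankel rank `WedgeC15General.hankel1_rank_twoEnded`) and the transverse pair `Aλ^j + Bμ^j` (`WedgePairShear`, by the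
shear automorphism).  NOT in the tree: th-6's THIRD face of ρ = 2, the TANGENT sequence `(A, B, 0, …, 0)` (class `A + BΘ`, `B ≠ 0` — in
the quoted dictionary the tangent line to the curve of exponentials `{exp(λΘ)}`, «Abel–Jacobi»), and the ρ = 1 face, ONE exponential
`Aλ^j` (class `A·exp(λΘ)`, «pure»).  THIS FILE (PLAIN: imports the built tree files `WedgeHankelGlue`, `WedgePairRank` only):
* §1 HANKEL MATRICES OF THE TWO SEQUENCES (column bookkeeping, as in `hankel1_rank_twoEnded`): **`rank_hankel1_tanSeq_mid`: rank
  H_k(A,B,0,…,0) = 2 for `0 < k < m`** (columns `A e₀ + B e₁`, `B e₀`, then zeros), **`= 1` at `k = 0` and at `k = m`** (`_zero`, `_top`;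
  `B ≠ 0`, `m ≥ 1`, `A` ARBITRARY — `A = 0` is the bare class `Θ`); assembled **`choose_mul_rank_hankel1_tanSeq`: `C(m,k)·rank H_k(A,B,0,…,0)
  = 2C(m,k) − [k=0] − [k=m]`** (`k ≤ m`); **`rank_hankel1_expSeq`: rank H_k(Aλ^{i+s}) = 1** (`A ≠ 0`, `k ≤ m`, every `λ` incl. `0`; all
  columns are multiples of `(λ^i)_i`).
* §2 THE WEDGE THEOREMS, by THEOREM H (no exterior-algebra computation in this file): **`finrank_range_wedge_w_tanSeq`: THEOREM T FOR THE
  TANGENT CLASS — `rank(θ ↦ θ ∧ (A·E₀ + B·E₁) ∣ ⋀^k K^{2m}) = 2C(m,k) − [k=0] − [k=m]` for EVERY `k`** (`m ≥ 1`, `B ≠ 0`, `A` arbitrary; `0`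
  for `k > m`), i.e. the tangent class has th-6's profile `P_m` exactly like the point pair and the transverse pair; **`finrank_range_wedge_w_expSeq`:
  THE PURE CLASS IS WEDGE-FULL ON ITS HALF — `rank(θ ↦ θ ∧ A·w_m(λ^j) ∣ ⋀^k) = C(m,k)` for every `k`** (`A ≠ 0`; profile `(1+t)^m`, never `P_m`
  for `m ≥ 2`: `C(m,1) = m < 2m`).
* §3 THE SAME IN th-6's TYPING (`FormulaN.wedgeWith`, transported along th-7's `Φ`, `Φ (vClass q) = w_m(q)`): **`tangentPairLawAt`:
  `finrank (range (wedgeWith k (A,B,0,…,0))) = transversePairRank m k`** (`m ≥ 1`, `B ≠ 0`; every field, every `k`) — the tangent clause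
  th-6's `FN4_classLevel` does not list, now a theorem beside `WedgePairGlue.pointPairLawAt` / `transversePairLawAt`; **`pureLawAt`:
  `finrank (range (wedgeWith k (Aλ^j))) = C(m,k)`**.
With `WedgeHankelBox` (p10 g10 leaf #1, chained on gen 6's `WedgeMixedBox`) these give the TANGENT BOX `Π P_{m_i}` and the PURE BOX `(1+t)^{Σ m_i}`
uniform in `n` — typed there, not here.  NOT typed: Hankel rank ≥ 3 («3C(n,2) on HT²», the generic face); the converse direction of the
dictionary (profile `P_m` ⇒ ρ = 2); anything Ext-side.  Class side only.
Namespace `Summit.Ventures.HSemireg.Wedge.HankelFaces` (new); new names only.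
-/

open Module

namespace Summit.Ventures.HSemireg.Wedge.HankelFaces

open Summit.Ventures.HSemireg.Wedge

variable (K : Type*) [Field K] (m : ℕ)

/-! ## §1. Hankel matrices of the tangent sequence `(A, B, 0, …, 0)` and of one exponential `Aλ^j` -/

/-- the TANGENT sequence `(A, B, 0, 0, …)`: the class `A + B·Θ` (th-6's «tangent (Abel–Jacobi)» face of Hankel rank 2). -/
def tanSeq (A B : K) : ℕ → K := fun j => (if j = 0 then A else 0) + (if j = 1 then B else 0)

/-- ONE EXPONENTIAL `q_j = A λ^j`: the class `A·exp(λΘ)` (th-6's «pure» face, Hankel rank 1). -/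
def expSeq (A lam : K) : ℕ → K := fun j => A * lam ^ j

/-- values of the tangent sequence. -/
@[simp] lemma tanSeq_apply (A B : K) (j : ℕ) : tanSeq K A B j = (if j = 0 then A else 0) + (if j = 1 then B else 0) := rfl

/-- values of the exponential sequence. -/
@[simp] lemma expSeq_apply (A lam : K) (j : ℕ) : expSeq K A lam j = A * lam ^ j := rfl

variable {m}

/-- **rank H_k(A, B, 0, …, 0) = 2 for `0 < k < m`, `B ≠ 0`** (its only non-zero columns are `A·e₀ + B·e₁` (first) and `B·e₀` (second);
`A` arbitrary). -/
theorem rank_hankel1_tanSeq_mid (A : K) {B : K} (hB : B ≠ 0) {k : ℕ} (hk0 : 0 < k) (hkm : k < m) :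
    (Hankel.hankel1 K m k (tanSeq K A B)).rank = 2 := by
  classical
  set M := Hankel.hankel1 K m k (tanSeq K A B) with hM
  let f : Fin 2 → Fin (k + 1) := fun j => ⟨j, by omega⟩
  have hf : Function.Injective f := by
    intro j j' h
    have h' := congrArg Fin.val h
    exact Fin.ext h'
  set u : Fin 2 → (Fin (k + 1) → K) := fun j => Pi.basisFun K (Fin (k + 1)) (f j) with hu
  have hli : LinearIndependent K u := (Pi.basisFun K (Fin (k + 1))).linearIndependent.comp _ hf
  have hcard : Module.finrank K (Submodule.span K (Set.range u)) = 2 := by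
    rw [finrank_span_eq_card hli, Fintype.card_fin]
  have hu0 : u 0 = Pi.single (⟨0, by omega⟩ : Fin (k + 1)) 1 := by
    rw [hu]
    simp only [Pi.basisFun_apply]
    rfl
  have hu1 : u 1 = Pi.single (⟨1, by omega⟩ : Fin (k + 1)) 1 := by
    rw [hu]
    simp only [Pi.basisFun_apply]
    rfl
  -- the columns
  have hcol0 : M.col ⟨0, by omega⟩ = A • u 0 + B • u 1 := by
    funext i
    rw [hu0, hu1, hM, Matrix.col_apply, Hankel.hankel1, Matrix.of_apply, tanSeq_apply]
    simp only [add_zero, Pi.add_apply, Pi.smul_apply, Pi.single_apply, smul_eq_mul, mul_ite, mul_one, mul_zero,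
      Fin.ext_iff]
  have hcol1 : M.col ⟨1, by omega⟩ = B • u 0 := by
    funext i
    have h1 : (i : ℕ) + 1 ≠ 0 := by omega
    have h2 : ((i : ℕ) + 1 = 1) ↔ (i : ℕ) = 0 := by omega
    rw [hu0, hM, Matrix.col_apply, Hankel.hankel1, Matrix.of_apply, tanSeq_apply]
    simp only [if_neg h1, zero_add, h2, Pi.smul_apply, Pi.single_apply, smul_eq_mul, mul_ite, mul_one, mul_zero,
      Fin.ext_iff]
  have hcol_other : ∀ s : Fin (m + 1 - k), 2 ≤ (s : ℕ) → M.col s = 0 := by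
    intro s hs
    funext i
    have h1 : (i : ℕ) + (s : ℕ) ≠ 0 := by omega
    have h2 : (i : ℕ) + (s : ℕ) ≠ 1 := by omega
    rw [hM, Matrix.col_apply, Hankel.hankel1, Matrix.of_apply, tanSeq_apply]
    simp only [if_neg h1, if_neg h2, add_zero, Pi.zero_apply]
  have hu0_mem : u 0 ∈ Submodule.span K (Set.range M.col) := by
    have : u 0 = B⁻¹ • M.col ⟨1, by omega⟩ := by
      rw [hcol1, smul_smul, inv_mul_cancel₀ hB, one_smul]
    rw [this]
    exact Submodule.smul_mem _ _ (Submodule.subset_span ⟨_, rfl⟩)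
  have hspan : Submodule.span K (Set.range M.col) = Submodule.span K (Set.range u) := by
    apply le_antisymm
    · apply Submodule.span_le.mpr
      rintro _ ⟨s, rfl⟩
      by_cases hs0 : (s : ℕ) = 0
      · have : s = ⟨0, by omega⟩ := Fin.ext hs0
        rw [this, hcol0]
        exact Submodule.add_mem _ (Submodule.smul_mem _ _ (Submodule.subset_span ⟨0, rfl⟩))
          (Submodule.smul_mem _ _ (Submodule.subset_span ⟨1, rfl⟩))
      by_cases hs1 : (s : ℕ) = 1
      · have : s = ⟨1, by omega⟩ := Fin.ext hs1
        rw [this, hcol1]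
        exact Submodule.smul_mem _ _ (Submodule.subset_span ⟨0, rfl⟩)
      · rw [hcol_other s (by omega)]
        exact Submodule.zero_mem _
    · apply Submodule.span_le.mpr
      rintro _ ⟨j, rfl⟩
      have hj : j = 0 ∨ j = 1 := by fin_cases j <;> simp
      rcases hj with rfl | rfl
      · exact hu0_mem
      · have : u 1 = B⁻¹ • (M.col ⟨0, by omega⟩ - A • u 0) := by
          rw [hcol0, add_sub_cancel_left, smul_smul, inv_mul_cancel₀ hB, one_smul]
        rw [this]
        exact Submodule.smul_mem _ _ (Submodule.sub_mem _ (Submodule.subset_span ⟨_, rfl⟩)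
          (Submodule.smul_mem _ _ hu0_mem))
  rw [Matrix.rank_eq_finrank_span_cols, hspan, hcard]

/-- **rank H_0(A, B, 0, …, 0) = 1** (`m ≥ 1`, `B ≠ 0`): one row `(A, B, 0, …, 0)` with at least two entries. -/
theorem rank_hankel1_tanSeq_zero (A : K) {B : K} (hB : B ≠ 0) (hm : 1 ≤ m) :
    (Hankel.hankel1 K m 0 (tanSeq K A B)).rank = 1 := by
  classical
  set M := Hankel.hankel1 K m 0 (tanSeq K A B) with hM
  let e : Fin (0 + 1) → K := fun _ => 1
  have he : e ≠ 0 := fun h => by simpa [e] using congr_fun h ⟨0, by omega⟩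
  have hcol : ∀ s : Fin (m + 1 - 0), M.col s = (tanSeq K A B (s : ℕ)) • e := by
    intro s
    funext i
    have hi : (i : ℕ) = 0 := by have := i.2; omega
    rw [hM, Matrix.col_apply, Hankel.hankel1, Matrix.of_apply, hi, zero_add]
    simp [e]
  have hspan : Submodule.span K (Set.range M.col) = K ∙ e := by
    apply le_antisymm
    · apply Submodule.span_le.mpr
      rintro _ ⟨s, rfl⟩
      rw [hcol]
      exact Submodule.smul_mem _ _ (Submodule.mem_span_singleton_self e)
    · rw [Submodule.span_singleton_le_iff_mem]
      have : e = B⁻¹ • M.col ⟨1, by omega⟩ := by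
        rw [hcol, tanSeq_apply]
        simp only [one_ne_zero, if_false, if_true, zero_add]
        rw [smul_smul, inv_mul_cancel₀ hB, one_smul]
      rw [this]
      exact Submodule.smul_mem _ _ (Submodule.subset_span ⟨_, rfl⟩)
  rw [Matrix.rank_eq_finrank_span_cols, hspan, finrank_span_singleton he]

/-- **rank H_m(A, B, 0, …, 0) = 1** (`m ≥ 1`, `B ≠ 0`): one column `(A, B, 0, …, 0)ᵀ`. -/
theorem rank_hankel1_tanSeq_top (A : K) {B : K} (hB : B ≠ 0) (hm : 1 ≤ m) :
    (Hankel.hankel1 K m m (tanSeq K A B)).rank = 1 := by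
  classical
  set M := Hankel.hankel1 K m m (tanSeq K A B) with hM
  let v : Fin (m + 1) → K := fun i => tanSeq K A B i
  have hv : v ≠ 0 := fun h => by
    have h1 := congr_fun h ⟨1, by omega⟩
    simp [v] at h1
    exact hB h1
  have hcol : ∀ s : Fin (m + 1 - m), M.col s = v := by
    intro s
    funext i
    have hs : (s : ℕ) = 0 := by have := s.2; omega
    rw [hM, Matrix.col_apply, Hankel.hankel1, Matrix.of_apply, hs, add_zero]
  have hspan : Submodule.span K (Set.range M.col) = K ∙ v := by
    apply le_antisymm
    · apply Submodule.span_le.mpr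
      rintro _ ⟨s, rfl⟩
      rw [hcol]
      exact Submodule.mem_span_singleton_self v
    · rw [Submodule.span_singleton_le_iff_mem, ← hcol ⟨0, by omega⟩]
      exact Submodule.subset_span ⟨_, rfl⟩
  rw [Matrix.rank_eq_finrank_span_cols, hspan, finrank_span_singleton hv]

/-- assembled: **`C(m,k) · rank H_k(A, B, 0, …, 0) = 2C(m,k) − [k = 0] − [k = m]`** for `k ≤ m` (`m ≥ 1`, `B ≠ 0`, `A` arbitrary) —
the tangent sequence has th-6's profile `P_m` through THEOREM H. -/
theorem choose_mul_rank_hankel1_tanSeq (hm : 1 ≤ m) (A : K) {B : K} (hB : B ≠ 0) {k : ℕ} (hk : k ≤ m) :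
    m.choose k * (Hankel.hankel1 K m k (tanSeq K A B)).rank = WedgePair.pointPairRank m k := by
  rcases Nat.eq_zero_or_pos k with rfl | hk0
  · rw [rank_hankel1_tanSeq_zero K A hB hm, Nat.choose_zero_right, WedgePair.pointPairRank, if_pos rfl,
      if_neg (by omega), Nat.choose_zero_right]
  · rcases eq_or_lt_of_le hk with rfl | hkm
    · rw [rank_hankel1_tanSeq_top K A hB hm, Nat.choose_self, WedgePair.pointPairRank, if_neg (by omega), if_pos rfl,
        Nat.choose_self]
    · rw [rank_hankel1_tanSeq_mid K A hB hk0 hkm, WedgePair.pointPairRank, if_neg (by omega), if_neg (by omega)]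
      omega

/-- **rank H_k(Aλ^{i+s}) = 1** for `k ≤ m`, `A ≠ 0`, every `λ` (all columns are multiples of `(λ^i)_{i ≤ k}`, the first one is `A` times it). -/
theorem rank_hankel1_expSeq {A : K} (hA : A ≠ 0) (lam : K) {k : ℕ} (hk : k ≤ m) :
    (Hankel.hankel1 K m k (expSeq K A lam)).rank = 1 := by
  classical
  set M := Hankel.hankel1 K m k (expSeq K A lam) with hM
  let u : Fin (k + 1) → K := fun i => lam ^ (i : ℕ)
  have hu : u ≠ 0 := fun h => by
    have h0 := congr_fun h ⟨0, by omega⟩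
    simp [u] at h0
  have hcol : ∀ s : Fin (m + 1 - k), M.col s = (A * lam ^ (s : ℕ)) • u := by
    intro s
    funext i
    rw [hM, Matrix.col_apply, Hankel.hankel1, Matrix.of_apply, expSeq_apply]
    simp only [u, Pi.smul_apply, smul_eq_mul]
    ring
  have hspan : Submodule.span K (Set.range M.col) = K ∙ u := by
    apply le_antisymm
    · apply Submodule.span_le.mpr
      rintro _ ⟨s, rfl⟩
      rw [hcol]
      exact Submodule.smul_mem _ _ (Submodule.mem_span_singleton_self u)
    · rw [Submodule.span_singleton_le_iff_mem]
      have : u = A⁻¹ • M.col ⟨0, by omega⟩ := by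
        rw [hcol]
        simp only [pow_zero, mul_one]
        rw [smul_smul, inv_mul_cancel₀ hA, one_smul]
      rw [this]
      exact Submodule.smul_mem _ _ (Submodule.subset_span ⟨_, rfl⟩)
  rw [Matrix.rank_eq_finrank_span_cols, hspan, finrank_span_singleton hu]

/-! ## §2. The wedge theorems on one factor, by THEOREM H -/

variable (m)

/-- **THEOREM T FOR THE TANGENT CLASS** (th-6's third face of Hankel rank 2): for `m ≥ 1`, `B ≠ 0`, `A` arbitrary and EVERY `k`,
`rank(θ ↦ θ ∧ w_m(A, B, 0, …, 0) ∣ ⋀^k K^{2m}) = 2C(m,k) − [k = 0] − [k = m]` (`= 0` for `k > m`), where `w_m(A,B,0,…,0) = A·E₀ + B·E₁`,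
`E₀ = x₀⋯x_{m−1}`, `E₁ = Σ_a x₀⋯y_a⋯x_{m−1}` (th-7's closed form `G_top`). -/
theorem finrank_range_wedge_w_tanSeq (hm : 1 ≤ m) (A : K) {B : K} (hB : B ≠ 0) (k : ℕ) :
    finrank K (LinearMap.range (Hankel.wedge K m k (Hankel.w K m m (tanSeq K A B)))) = WedgePair.pointPairRank m k := by
  rw [Hankel.hankelLaw_model]
  rcases Nat.lt_or_ge m k with hk | hk
  · rw [Nat.choose_eq_zero_of_lt hk, zero_mul, WedgePair.pointPairRank, Nat.choose_eq_zero_of_lt hk, if_neg (by omega),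
      if_neg (by omega), mul_zero, Nat.sub_zero, Nat.sub_zero]
  · exact choose_mul_rank_hankel1_tanSeq K hm A hB hk

/-- **THE PURE CLASS IS WEDGE-FULL ON ITS HALF**: for `A ≠ 0`, every `λ` and EVERY `k`,
`rank(θ ↦ θ ∧ w_m(Aλ^j) ∣ ⋀^k K^{2m}) = C(m,k)` (`w_m(λ^j) = Π_a (x_a + λ y_a)`, th-7's ordered binomial expansion; profile `(1+t)^m`). -/
theorem finrank_range_wedge_w_expSeq {A : K} (hA : A ≠ 0) (lam : K) (k : ℕ) :
    finrank K (LinearMap.range (Hankel.wedge K m k (Hankel.w K m m (expSeq K A lam)))) = m.choose k := by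
  rw [Hankel.hankelLaw_model]
  rcases Nat.lt_or_ge m k with hk | hk
  · rw [Nat.choose_eq_zero_of_lt hk, zero_mul]
  · rw [rank_hankel1_expSeq K hA lam hk, mul_one]

/-- the two profiles differ from `m = 2` on: in degree `1` the pure class has rank `m`, the tangent / point / transverse pairs `2m`. -/
theorem pointPairRank_one_eq_two_mul (hm : 2 ≤ m) : WedgePair.pointPairRank m 1 = 2 * m.choose 1 := by
  rw [WedgePair.pointPairRank, if_neg (by omega), if_neg (by omega), Nat.sub_zero, Nat.sub_zero]

/-! ## §3. The same in th-6's typing (`FormulaN.wedgeWith`), transported along th-7's reindexing `Φ` -/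

/-- ranks along `Φ`: th-6's `wedgeWith k q` has the rank of `θ ↦ θ ∧ w_m(q)` (`Φ (vClass q) = w_m(q)`, THEOREM H's glue). -/
lemma finrank_range_wedgeWith_eq_w (k : ℕ) (q : ℕ → K) :
    finrank K (LinearMap.range (FormulaN.wedgeWith K m k q)) =
      finrank K (LinearMap.range (Hankel.wedge K m k (Hankel.w K m m q))) := by
  rw [← Hankel.Φ_vClass K m q, ← Hankel.map_Φ_range_wedgeWith K m k q]
  exact (LinearEquiv.finrank_map_eq (Hankel.Φ K m).toLinearEquiv _).symm

/-- **THE TANGENT PAIR LAW in th-6's typing**: for `m ≥ 1`, `B ≠ 0`, `A` arbitrary, every field and every `k`,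
`finrank (range (wedgeWith k (A, B, 0, …, 0))) = transversePairRank m k` — the clause th-6's `FN4_classLevel` leaves implicit
(«… or tangent ⟹ P_n»), beside `WedgePairGlue.pointPairLawAt` / `transversePairLawAt`. -/
theorem tangentPairLawAt (hm : 1 ≤ m) (A : K) {B : K} (hB : B ≠ 0) (k : ℕ) :
    finrank K (LinearMap.range (FormulaN.wedgeWith K m k fun j => (if j = 0 then A else 0) + (if j = 1 then B else 0))) =
      FormulaN.transversePairRank m k := by
  rw [finrank_range_wedgeWith_eq_w]
  exact finrank_range_wedge_w_tanSeq K m hm A hB k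

/-- **THE PURE LAW in th-6's typing**: for `A ≠ 0`, every `λ`, every field and every `k`,
`finrank (range (wedgeWith k (Aλ^j))) = C(m,k)` (C15's ρ = 1 face: `(1+t)^m`). -/
theorem pureLawAt {A : K} (hA : A ≠ 0) (lam : K) (k : ℕ) :
    finrank K (LinearMap.range (FormulaN.wedgeWith K m k fun j => A * lam ^ j)) = m.choose k := by
  rw [finrank_range_wedgeWith_eq_w]
  exact finrank_range_wedge_w_expSeq K m hA lam k

/-- the bare polarisation class `Θ` (`A = 0`, `B = 1`): `rank(θ ↦ θ ∧ E₁ ∣ ⋀^k) = 2C(m,k) − [k=0] − [k=m]` (`m ≥ 1`) — `Θ` alone already has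
the full profile `P_m`. -/
theorem finrank_range_wedge_w_theta (hm : 1 ≤ m) (k : ℕ) :
    finrank K (LinearMap.range (Hankel.wedge K m k (Hankel.w K m m (tanSeq K 0 1)))) = WedgePair.pointPairRank m k :=
  finrank_range_wedge_w_tanSeq K m hm 0 one_ne_zero k

end Summit.Ventures.HSemireg.Wedge.HankelFaces
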